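import Literature.MathematicalPhysics.QuantumFieldTheory.Balaban1983to89.T4CubeShellBlocks

/-!
# `Balaban1983to89.T4CubeShellTowerMarkov` — SHELL CONDITIONING OF THE WINDOWED GIBBS LAW ON A CUBE, II: the TOWER PROPERTY
# `E_μ[F] = E_μ[E_μ[F | x_shell]]` by a measure-preserving coordinate-exchange involution of `K × K` (consistency of the Gibbsian
# kernels, [FriedliVelenik2017] Lemma 6.7 (6.7)–(6.10), §6.10.1 (6.110) with Lemma 6.15; R. Durrett, *Probability* 5th ed. 2019 =
# [Durrett2019] Thm 4.1.13), BLOCK FACTORISATION ([Durrett2019] Thm 2.1.12) and the SPATIAL MARKOV ∕ TOTAL-COVARIANCE IDENTITY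
# across a separating shell ([FriedliVelenik2017] Exercise 3.11 (3.26): conditioned on `Λ ∖ Δ` the Gibbs distribution in `Λ` is
# the Gibbs distribution in `Δ` and «really only depends on `ω'_i` for `i ∈ ∂^ex Δ`»)

statement-and-proof file: textbook probability on the tree's cube model, every public declaration cite-tagged; nothing here is a
claim about the Yang–Mills mass gap

CITATION HEADER (lean-in-tree rule).  Ideation cell `ym-nodeO-ideate` (portfolio track), seat P8 «dual witness for the
β-interval bounds», memo `memos/ROUTE-p8.md` (v7.0 sha256 3f529b57…, referee REF g47 PASS 2026-08-27; v7.1 §72 records this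
edition).  LANDING EDITION (generation 10), module II of 3 («CubeShell I–III») of the memo companion
`memos/ROUTE-p8-SketchG7.lean` («G7», sha256 ee65fa81…, 1229 l., 65 declarations, 0 `sorry`, 0 `axiom`; REF g47 farm replication
rc 0, axioms standard): G7 §3 :259–:484 (the `Tower` section, whole) and G7 §8 :1023–:1227 (the `Markov` section, whole).
Statements and proof terms are CHARACTER-IDENTICAL to G7's; edition deltas = namespace (`YMNodeOIdeate.P8g7` → this module's),
this header, the three-module split with imports, per-declaration cite tags replacing G7's bare folklore tags (each names the
printed statement the declaration formalises or serves on the cube model; proofs ours), one-line docstrings added to helpers G7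
left bare, memo labels neutralised in docstrings; `private`: `blockSwap_apply`, `measurePreserving_blockSwap`,
`swapEquiv_preimage_prod`, `olab_eq_one`, `olab_ne_one`, `fin3_eq_two`, `div_eq_div_of_factor`, `div_eq_div_of_factor'`,
`div_eq_div_mul_div_of_factor`.  LABELS (memo-side words, NOT tree declarations): «(D1)»–«(D5)» = the five measure-side inputs
of the memo's level-0 «conditioning ∕ scale-doubling» scheme for covariance decay of windowed Gibbs laws (a quadratic scale
recursion `κ(2m) ≤ c·κ(m)² + η` fed by Brascamp–Lieb on the window, shell conditioning and the response identity) — the scheme,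
its seed and its analytic inputs are NOT in the tree; labels `lab : Fin n → Fin 3`: `0` inside, `1` shell, `2` outside.

HONEST FRAMING.  Nothing here is printed in Bałaban's papers and nothing is asserted about his densities: every declaration is
[folklore] probability ∕ calculus — the cube-window, continuous-spin instance of the cited textbook statements — on the TREE's
Euclidean cube model of a one-step fluctuation fibre `Balaban1983to89.T4CubePoincare` (`cube n S = [-S,S]ⁿ`, `cubeMass`,
`cubeMean`, `cubeVar`, the windowed Gibbs law `μ_K ∝ e^{-f} 1_K dx`, the convexity input `HessianBound f λ`).

WHAT IS PROVED (no `sorry`, no new axiom; `#print axioms cubeMean_shellMean ∕ cubeCov_markov` = {propext, Classical.choice, Quot.sound}).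
* §1 The device: `blockSwap c` (identity ∕ coordinate swap of `ℝ × ℝ`), the `MeasurableEquiv` **`swapEquiv lab : (x,z) ↦ (merge x z,
  merge z x)`** of `(Fin n → ℝ) × (Fin n → ℝ)` (Mathlib `MeasurableEquiv.arrowProdEquivProdArrow`, `piCongrRight` with `refl ∕
  prodComm` per coordinate), `swapEquiv_apply`, `measurePreserving_swapEquiv` (`volume_preserving_pi`), `merge_merge_swap`,
  `mem_cube_of_merge_mem`, `measurePreserving_swapEquiv_restrict` (it preserves `volume` restricted to `K × K`) — the continuum
  form of the resummation over `ω_Δ, ω'_Δ` in the proof of [FriedliVelenik2017] Lemma 6.7, (6.8)–(6.10); regularity of the kernel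
  in the boundary condition `continuous_merge₂`, `continuous_shellMass ∕ Num ∕ Mean` (`S > 0`; Mathlib
  `continuous_parametric_integral_of_continuous`); the lifted integrands `towerG`, `towerG'` with `towerG_swapEquiv`, continuity,
  set integrals; and the TOWER PROPERTY **`cubeMean_shellMean`**: `cubeMean f S F = cubeMean f S (shellMean lab f S F)` for
  `0 < S`, `f, F` continuous, ANY labelling (`integral_prod` + `MeasurePreserving.integral_comp'`; no conditional-expectation ∕
  disintegration API).
* §2 `olab lab` (relabelling «outside vs. rest»); **`volumeReal_mul_setIntegral_mul`**: `vol(K)·∫_K a·b = (∫_K a)·(∫_K b)` for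
  continuous `a` blind to the outside block and `b` seeing only it (independence of disjoint coordinate blocks under the uniform
  law, [Durrett2019] Thm 2.1.12; proved with `swapEquiv (olab lab)` and `integral_prod_mul`); `merge_congr_right`,
  `apply_merge_eq_of_dependsOn(_outside)` ([FriedliVelenik2017] Lemma 6.3); **`shellMean_split`**: if `f = f₁ + f₂` with `f₁`
  blind to the outside and `f₂` blind to the inside block then `E_f[F | x_shell] = E_(f₁)[F | x_shell]` for `F` blind to the
  outside block; **`cubeCov_markov`** «(D2)»: for such `f` and `F` (resp. `H`) blind to the outside (resp. inside) block,
  `Cov_μ(F,H) = Cov_μ(E_(f₁)[F | shell], E_(f₂)[H | shell])` EXACTLY — the law of total covariance with vanishing conditional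
  covariance (conditional independence of the blocks given the shell = (3.26)), from `cubeMean_shellMean` + `cubeCov_eq_sub`.

NEAREST TREE ∕ MATHLIB ITEMS (dedup census; nothing restated).  The GENERAL, event-level consistency of Gibbsian specifications
with an a priori measure IS in the tree: `Literature.Probability.LatticeModels.GibbsSpecificationTilted.
lintegral_tilted_map_glueWith_pi_consistent` ∕ `isSpecification_tilted_map_glueWith_pi` ([FriedliVelenik2017] Lemma 6.15,
§6.10.1; carrier `Measure.tilted ((Measure.pi ν).map (glueWith Λ · η))`, indicator events, bounded measurable energies).
`cubeMean_shellMean` is the FUNCTION-level instance on the `T4CubePoincare` carrier (`∫ x in cube n S … ∂volume`, continuous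
`f, F`, energies unbounded off the window), proved directly on that carrier because §2 and module III factorise and differentiate
these very set integrals; the transport between the carriers (events → continuous integrands, `Measure.pi (volume.restrict
[-S,S]) ∘ glueWith` ↔ `volume.restrict (cube n S)`, `tilted` ↔ `e^(−f)∕Z`) is not in the tree and is of comparable length.
One-site siblings: `T4DobrushinTensorisation.resamplingInvariant_gibbs` (heat-bath invariance of a bounded-energy Gibbs law on an
abstract product space) and `T4GibbsKernelFeller.continuous_integral_gibbsKernel` (one-site Feller continuity, cf.
`continuous_shellMean`).  Markov-type statements on other carriers: `LatticeModels.MarkovWindowDensity ∕ MarkovWindowPeeling`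
(transfer-kernel chains on `ℤ → S`: Mathlib `lmarginal` of `ℝ≥0∞` densities with `DependsOn` bookkeeping, e.g.
`lmarginal_mul_left_of_dependsOn'` — the nearest `DependsOn`-based factorisation, nearest-neighbour kernels in one dimension),
`DiscreteGFFMarkov` (domain Markov property of the lattice GFF), `GibbsStrongMarkov` (strong Markov property of abstract
specifications, events); none states the conditional independence of two coordinate blocks of a windowed Gibbs density on `ℝⁿ`
given a separating block for a general splitting `f = f₁ + f₂`, or the total-covariance identity.  `AnovaDecomposition.
integral_condMean ∕ condMean_condMean ∕ glue` = tower ∕ factorisation for PRODUCT measures.  Mathlib: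
`MeasurableEquiv.arrowProdEquivProdArrow ∕ piCongrRight ∕ prodComm`, `volume_preserving_pi`, `Measure.measurePreserving_swap`,
`Measure.prod_restrict`, `MeasurePreserving.integral_comp'`, `integral_prod`, `integral_prod_mul`, `measureReal_def`, `DependsOn`.

CAVEATS ∕ NOT HERE.  (MODEL) the fibre is `ℝⁿ` with Lebesgue measure and a cube window, as in `T4CubePoincare`; Bałaban's
fibre is a product of group copies read in a chart — that TRANSPORT is not here.  (RAW) no integrability hypotheses (compact cube,
continuous integrands); `S > 0` wherever a mass is inverted.  NOT HERE: any decay statement, any log-Sobolev ∕ cumulant BOUND,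
any Combes–Thomas seed, the scale-recursion certificate, balls instead of cubes, anything about Bałaban's densities, [B12]
Theorem 2 or the cell's target `B13TermWalkDataOneTorus.ExistsUniformAcrossSmall`.  Value = kernel-checked measure-side identities
of the cube model, usable by name; NOT summit progress; no YM-PLAN ∕ Track-B node is claimed closed.  NEW file, imports built tree
modules only (and the earlier modules of this series); nothing modified; dimension-generic; net new unproved facts: 0.
[cite: FriedliVelenik2017, Lemma 6.7 (6.7)–(6.10), §6.10.1 (6.110) with Lemma 6.15, Exercise 3.11 (3.26), Lemma 6.3; Durrett2019, Thm 4.1.13, Thm 2.1.12] -/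

set_option autoImplicit false

open MeasureTheory Set
open scoped Topology

namespace Literature.MathematicalPhysics.QuantumFieldTheory.Balaban1983to89.T4CubeShellTowerMarkov

open Literature.MathematicalPhysics.QuantumFieldTheory.Balaban1983to89.T4CubePoincare
open Literature.MathematicalPhysics.QuantumFieldTheory.Balaban1983to89.T4CubeShellBlocks
open Literature.Probability.Distributions

variable {n : ℕ}

/-! ## §1 The measure-preserving swap involution on `K × K` and the tower property -/

section Tower

/-- Per-coordinate block map on `ℝ × ℝ`: identity on a shell coordinate, swap of the two copies otherwise. [cite: FriedliVelenik2017, Lemma 6.7 (6.7)–(6.10)] -/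
noncomputable def blockSwap (c : Fin 3) : ℝ × ℝ ≃ᵐ ℝ × ℝ :=
  if c = 1 then MeasurableEquiv.refl (ℝ × ℝ) else MeasurableEquiv.prodComm

/-- `blockSwap c` unfolded: the identity if `c = 1`, the coordinate swap of `ℝ × ℝ` otherwise. [folklore] -/
private theorem blockSwap_apply (c : Fin 3) (q : ℝ × ℝ) : blockSwap c q = if c = 1 then q else q.swap := by
  unfold blockSwap
  split_ifs <;> rfl

/-- Each block map preserves Lebesgue measure on `ℝ × ℝ` (`Measure.measurePreserving_swap`). [folklore] -/
private theorem measurePreserving_blockSwap (c : Fin 3) : MeasurePreserving (blockSwap c) volume volume := by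
  unfold blockSwap
  split_ifs
  · exact MeasurePreserving.id volume
  · show MeasurePreserving Prod.swap ((volume : Measure ℝ).prod volume) ((volume : Measure ℝ).prod volume)
    exact Measure.measurePreserving_swap

/-- THE SWAP INVOLUTION `(x,z) ↦ (merge x z, merge z x)` as a measurable equivalence of `ℝⁿ × ℝⁿ`: zip to
`Fin n → ℝ × ℝ`, act blockwise by `blockSwap (lab i)`, unzip. [cite: FriedliVelenik2017, Lemma 6.7 (6.7)–(6.10)] -/
noncomputable def swapEquiv (lab : Fin n → Fin 3) : ((Fin n → ℝ) × (Fin n → ℝ)) ≃ᵐ ((Fin n → ℝ) × (Fin n → ℝ)) :=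
  ((MeasurableEquiv.arrowProdEquivProdArrow ℝ ℝ (Fin n)).symm.trans
      (MeasurableEquiv.piCongrRight fun i => blockSwap (lab i))).trans
    (MeasurableEquiv.arrowProdEquivProdArrow ℝ ℝ (Fin n))

/-- The swap involution unfolded: `swapEquiv lab (x, z) = (merge lab x z, merge lab z x)`. [cite: FriedliVelenik2017, Lemma 6.7 (6.7)–(6.10)] -/
theorem swapEquiv_apply (lab : Fin n → Fin 3) (p : (Fin n → ℝ) × (Fin n → ℝ)) :
    swapEquiv lab p = (merge lab p.1 p.2, merge lab p.2 p.1) := by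
  refine Prod.ext (funext fun i => ?_) (funext fun i => ?_)
  · show (blockSwap (lab i) (p.1 i, p.2 i)).1 = merge lab p.1 p.2 i
    rw [blockSwap_apply]
    unfold merge
    split_ifs <;> rfl
  · show (blockSwap (lab i) (p.1 i, p.2 i)).2 = merge lab p.2 p.1 i
    rw [blockSwap_apply]
    unfold merge
    split_ifs <;> rfl

/-- The swap involution preserves Lebesgue measure on `ℝⁿ × ℝⁿ`. [cite: FriedliVelenik2017, Lemma 6.7 (6.7)–(6.10)] -/
theorem measurePreserving_swapEquiv (lab : Fin n → Fin 3) :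
    MeasurePreserving (swapEquiv lab) volume volume := by
  have hA := volume_measurePreserving_arrowProdEquivProdArrow ℝ ℝ (Fin n)
  have hP : MeasurePreserving (MeasurableEquiv.piCongrRight fun i => blockSwap (lab i)) volume volume :=
    volume_preserving_pi (α' := fun _ : Fin n => ℝ × ℝ) (β' := fun _ : Fin n => ℝ × ℝ)
      (f := fun i => ⇑(blockSwap (lab i))) fun i => measurePreserving_blockSwap (lab i)
  exact ((hA.symm _).trans hP).trans hA

/-- The swap involution undoes itself on the first component: `merge (merge x z) (merge z x) = x`. [cite: FriedliVelenik2017, Lemma 6.7 (6.7)–(6.10)] -/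
theorem merge_merge_swap (lab : Fin n → Fin 3) (x z : Fin n → ℝ) :
    merge lab (merge lab x z) (merge lab z x) = x := by
  funext i
  unfold merge
  split_ifs <;> rfl

/-- If both `merge x z` and `merge z x` lie in the cube then so does `x`. [cite: FriedliVelenik2017, Lemma 6.7 (6.7)–(6.10)] -/
theorem mem_cube_of_merge_mem {lab : Fin n → Fin 3} {S : ℝ} {x z : Fin n → ℝ}
    (h1 : merge lab x z ∈ cube n S) (h2 : merge lab z x ∈ cube n S) : x ∈ cube n S := by
  rw [mem_cube_iff] at h1 h2 ⊢
  intro i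
  by_cases hi : lab i = 1
  · have h := h1 i
    rwa [merge_apply_shell hi] at h
  · have h := h2 i
    rwa [merge_apply_of_ne hi] at h

/-- `K × K` is invariant under the swap involution. [folklore] -/
private theorem swapEquiv_preimage_prod (lab : Fin n → Fin 3) (S : ℝ) :
    swapEquiv lab ⁻¹' (cube n S ×ˢ cube n S) = cube n S ×ˢ cube n S := by
  ext p
  simp only [Set.mem_preimage, swapEquiv_apply, Set.mem_prod]
  constructor
  · rintro ⟨h1, h2⟩
    exact ⟨mem_cube_of_merge_mem h1 h2, mem_cube_of_merge_mem h2 h1⟩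
  · rintro ⟨h1, h2⟩
    exact ⟨merge_mem_cube h1 h2, merge_mem_cube h2 h1⟩

/-- The swap involution preserves Lebesgue measure restricted to `K × K`. [cite: FriedliVelenik2017, Lemma 6.7 (6.7)–(6.10)] -/
theorem measurePreserving_swapEquiv_restrict (lab : Fin n → Fin 3) (S : ℝ) :
    MeasurePreserving (swapEquiv lab) (volume.restrict (cube n S ×ˢ cube n S))
      (volume.restrict (cube n S ×ˢ cube n S)) := by
  have h := (measurePreserving_swapEquiv lab).restrict_preimage
    ((measurableSet_cube' n S).prod (measurableSet_cube' n S))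
  rwa [swapEquiv_preimage_prod] at h

/-- `(x,z) ↦ merge lab x z` is jointly continuous. [cite: FriedliVelenik2017, Lemma 6.7 (6.7)–(6.10)] -/
theorem continuous_merge₂ (lab : Fin n → Fin 3) :
    Continuous fun p : (Fin n → ℝ) × (Fin n → ℝ) => merge lab p.1 p.2 := by
  refine continuous_pi fun i => ?_
  by_cases hi : lab i = 1
  · simp only [merge, hi, if_true]; exact (continuous_apply i).comp continuous_fst
  · simp only [merge, hi, if_false]; exact (continuous_apply i).comp continuous_snd

/-- The conditional mass is continuous in the shell configuration. [cite: FriedliVelenik2017, §6.10.1 (6.110)] -/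
theorem continuous_shellMass (lab : Fin n → Fin 3) {f : (Fin n → ℝ) → ℝ} (hf : Continuous f) (S : ℝ) :
    Continuous (shellMass lab f S) := by
  have hK : IsCompact (cube n S) := isCompact_cube n S
  have hc : Continuous fun p : (Fin n → ℝ) × (Fin n → ℝ) => Real.exp (-f (merge lab p.1 p.2)) :=
    Real.continuous_exp.comp (hf.comp (continuous_merge₂ lab)).neg
  exact continuous_parametric_integral_of_continuous (μ := (volume : Measure (Fin n → ℝ)))
    (f := fun (x : Fin n → ℝ) (z : Fin n → ℝ) => Real.exp (-f (merge lab x z))) hc hK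

/-- The numerator of the conditional mean is continuous in the shell configuration. [cite: FriedliVelenik2017, §6.10.1 (6.110)] -/
theorem continuous_shellNum (lab : Fin n → Fin 3) {f F : (Fin n → ℝ) → ℝ} (hf : Continuous f)
    (hF : Continuous F) (S : ℝ) :
    Continuous fun x => ∫ z in cube n S, F (merge lab x z) * Real.exp (-f (merge lab x z)) := by
  have hK : IsCompact (cube n S) := isCompact_cube n S
  have hc : Continuous fun p : (Fin n → ℝ) × (Fin n → ℝ) =>
      F (merge lab p.1 p.2) * Real.exp (-f (merge lab p.1 p.2)) :=
    (hF.comp (continuous_merge₂ lab)).mul (Real.continuous_exp.comp (hf.comp (continuous_merge₂ lab)).neg)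
  exact continuous_parametric_integral_of_continuous (μ := (volume : Measure (Fin n → ℝ)))
    (f := fun (x : Fin n → ℝ) (z : Fin n → ℝ) => F (merge lab x z) * Real.exp (-f (merge lab x z))) hc hK

/-- The conditional mean of a continuous insert is continuous. [cite: FriedliVelenik2017, §6.10.1 (6.110)] -/
theorem continuous_shellMean (lab : Fin n → Fin 3) {f F : (Fin n → ℝ) → ℝ} (hf : Continuous f)
    (hF : Continuous F) {S : ℝ} (hS : 0 < S) : Continuous (shellMean lab f S F) := by
  have h : Continuous fun x => (∫ z in cube n S, F (merge lab x z) * Real.exp (-f (merge lab x z)))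
      / shellMass lab f S x :=
    (continuous_shellNum lab hf hF S).div (continuous_shellMass lab hf S) fun x => (shellMass_pos lab hf hS x).ne'
  exact h

/-- The lifted integrand on `K × K` before the swap. [cite: FriedliVelenik2017, Lemma 6.7 (6.7)–(6.10)] -/
noncomputable def towerG (lab : Fin n → Fin 3) (f : (Fin n → ℝ) → ℝ) (S : ℝ) (F : (Fin n → ℝ) → ℝ)
    (p : (Fin n → ℝ) × (Fin n → ℝ)) : ℝ :=
  F (merge lab p.1 p.2) * Real.exp (-f (merge lab p.1 p.2)) * (Real.exp (-f p.1) / shellMass lab f S p.1)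

/-- The lifted integrand on `K × K` after the swap. [cite: FriedliVelenik2017, Lemma 6.7 (6.7)–(6.10)] -/
noncomputable def towerG' (lab : Fin n → Fin 3) (f : (Fin n → ℝ) → ℝ) (S : ℝ) (F : (Fin n → ℝ) → ℝ)
    (p : (Fin n → ℝ) × (Fin n → ℝ)) : ℝ :=
  F p.1 * Real.exp (-f p.1) / shellMass lab f S p.1 * Real.exp (-f (merge lab p.1 p.2))

/-- The swap involution carries the lifted integrand `towerG` to `towerG'` (`merge_merge_swap` and the
shell-dependence of the conditional mass). [cite: FriedliVelenik2017, Lemma 6.7 (6.7)–(6.10)] -/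
theorem towerG_swapEquiv (lab : Fin n → Fin 3) (f : (Fin n → ℝ) → ℝ) (S : ℝ) (F : (Fin n → ℝ) → ℝ)
    (p : (Fin n → ℝ) × (Fin n → ℝ)) : towerG lab f S F (swapEquiv lab p) = towerG' lab f S F p := by
  have hM : shellMass lab f S (merge lab p.1 p.2) = shellMass lab f S p.1 :=
    shellMass_dependsOn lab f S (fun i hi => merge_apply_shell hi p.1 p.2)
  simp only [towerG, towerG', swapEquiv_apply, merge_merge_swap, hM]
  ring

/-- The lifted integrand `towerG` is continuous (`S > 0`, `f, F` continuous). [cite: FriedliVelenik2017, Lemma 6.7 (6.7)–(6.10)] -/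
theorem continuous_towerG (lab : Fin n → Fin 3) {f F : (Fin n → ℝ) → ℝ} (hf : Continuous f) (hF : Continuous F)
    {S : ℝ} (hS : 0 < S) : Continuous (towerG lab f S F) := by
  have hm := continuous_merge₂ lab
  have hE : Continuous fun y : Fin n → ℝ => Real.exp (-f y) := continuous_expNeg hf
  have h : Continuous fun p : (Fin n → ℝ) × (Fin n → ℝ) =>
      F (merge lab p.1 p.2) * Real.exp (-f (merge lab p.1 p.2)) * (Real.exp (-f p.1) / shellMass lab f S p.1) :=
    ((hF.comp hm).mul (hE.comp hm)).mul
      ((hE.comp continuous_fst).div ((continuous_shellMass lab hf S).comp continuous_fst)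
        fun p => (shellMass_pos lab hf hS p.1).ne')
  exact h

/-- The swapped integrand `towerG'` is continuous (`S > 0`, `f, F` continuous). [cite: FriedliVelenik2017, Lemma 6.7 (6.7)–(6.10)] -/
theorem continuous_towerG' (lab : Fin n → Fin 3) {f F : (Fin n → ℝ) → ℝ} (hf : Continuous f) (hF : Continuous F)
    {S : ℝ} (hS : 0 < S) : Continuous (towerG' lab f S F) := by
  have hm := continuous_merge₂ lab
  have hE : Continuous fun y : Fin n → ℝ => Real.exp (-f y) := continuous_expNeg hf
  have h : Continuous fun p : (Fin n → ℝ) × (Fin n → ℝ) =>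
      F p.1 * Real.exp (-f p.1) / shellMass lab f S p.1 * Real.exp (-f (merge lab p.1 p.2)) :=
    (((hF.comp continuous_fst).mul (hE.comp continuous_fst)).div
      ((continuous_shellMass lab hf S).comp continuous_fst) fun p => (shellMass_pos lab hf hS p.1).ne').mul
      (hE.comp hm)
  exact h

/-- Inner `z`-integral of the lifted integrand = the integrand of `E[E[F|shell]]`. [cite: FriedliVelenik2017, Lemma 6.7 (6.7)–(6.10)] -/
theorem setIntegral_towerG (lab : Fin n → Fin 3) (f : (Fin n → ℝ) → ℝ) (S : ℝ) (F : (Fin n → ℝ) → ℝ)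
    (x : Fin n → ℝ) :
    ∫ z in cube n S, towerG lab f S F (x, z) = shellMean lab f S F x * Real.exp (-f x) := by
  show (∫ z in cube n S, F (merge lab x z) * Real.exp (-f (merge lab x z))
      * (Real.exp (-f x) / shellMass lab f S x)) = _
  rw [integral_mul_const]
  simp only [shellMean]
  ring

/-- Inner `z`-integral of the swapped integrand = the integrand of `E[F]`. [cite: FriedliVelenik2017, Lemma 6.7 (6.7)–(6.10)] -/
theorem setIntegral_towerG' (lab : Fin n → Fin 3) {f : (Fin n → ℝ) → ℝ} (hf : Continuous f) {S : ℝ} (hS : 0 < S)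
    (F : (Fin n → ℝ) → ℝ) (x : Fin n → ℝ) :
    ∫ z in cube n S, towerG' lab f S F (x, z) = F x * Real.exp (-f x) := by
  show (∫ z in cube n S, F x * Real.exp (-f x) / shellMass lab f S x * Real.exp (-f (merge lab x z))) = _
  rw [integral_const_mul]
  have hM : (∫ z in cube n S, Real.exp (-f (merge lab x z))) = shellMass lab f S x := rfl
  rw [hM]
  exact div_mul_cancel₀ _ (shellMass_pos lab hf hS x).ne'

/-- **(D2-tower) THE TOWER PROPERTY (PROVED).**  `E_μ[F] = E_μ[E_μ[F | x_shell]]` for the windowed Gibbs law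
`μ = μ_K ∝ e^{-f} 1_{[-S,S]ⁿ}`, `f, F` continuous.  Proof: lift `∫_K E[F|shell] e^{-f}` to `K × K` (Fubini,
`integral_prod` + `Measure.prod_restrict`), apply the measure-preserving swap involution `swapEquiv`
(`MeasurePreserving.integral_comp'`), and integrate `z` out. [cite: FriedliVelenik2017, Lemma 6.7 (6.7)–(6.10); FriedliVelenik2017, §6.10.1 (6.110) with Lemma 6.15; Durrett2019, Thm 4.1.13] -/
theorem cubeMean_shellMean {S : ℝ} (hS : 0 < S) (lab : Fin n → Fin 3) {f F : (Fin n → ℝ) → ℝ}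
    (hf : Continuous f) (hF : Continuous F) :
    cubeMean f S F = cubeMean f S (shellMean lab f S F) := by
  have hK : IsCompact (cube n S) := isCompact_cube n S
  have hμ : ((volume : Measure (Fin n → ℝ)).restrict (cube n S)).prod
      ((volume : Measure (Fin n → ℝ)).restrict (cube n S))
      = (volume : Measure ((Fin n → ℝ) × (Fin n → ℝ))).restrict (cube n S ×ˢ cube n S) := by
    rw [Measure.prod_restrict, ← Measure.volume_eq_prod]
  have hGi : Integrable (towerG lab f S F)
      (((volume : Measure (Fin n → ℝ)).restrict (cube n S)).prod
        ((volume : Measure (Fin n → ℝ)).restrict (cube n S))) := by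
    rw [hμ]
    exact (continuous_towerG lab hf hF hS).continuousOn.integrableOn_compact (hK.prod hK)
  have hG'i : Integrable (towerG' lab f S F)
      (((volume : Measure (Fin n → ℝ)).restrict (cube n S)).prod
        ((volume : Measure (Fin n → ℝ)).restrict (cube n S))) := by
    rw [hμ]
    exact (continuous_towerG' lab hf hF hS).continuousOn.integrableOn_compact (hK.prod hK)
  have hchain : (∫ x in cube n S, shellMean lab f S F x * Real.exp (-f x))
      = ∫ x in cube n S, F x * Real.exp (-f x) := by
    calc (∫ x in cube n S, shellMean lab f S F x * Real.exp (-f x))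
        = ∫ x in cube n S, ∫ z in cube n S, towerG lab f S F (x, z) := by
          congr 1
          funext x
          exact (setIntegral_towerG lab f S F x).symm
      _ = ∫ p, towerG lab f S F p ∂(((volume : Measure (Fin n → ℝ)).restrict (cube n S)).prod
            ((volume : Measure (Fin n → ℝ)).restrict (cube n S))) := (integral_prod _ hGi).symm
      _ = ∫ p in cube n S ×ˢ cube n S, towerG lab f S F p := by rw [hμ]
      _ = ∫ p in cube n S ×ˢ cube n S, towerG lab f S F (swapEquiv lab p) :=
          ((measurePreserving_swapEquiv_restrict lab S).integral_comp' (towerG lab f S F)).symm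
      _ = ∫ p in cube n S ×ˢ cube n S, towerG' lab f S F p := by
          congr 1
          funext p
          exact towerG_swapEquiv lab f S F p
      _ = ∫ p, towerG' lab f S F p ∂(((volume : Measure (Fin n → ℝ)).restrict (cube n S)).prod
            ((volume : Measure (Fin n → ℝ)).restrict (cube n S))) := by rw [hμ]
      _ = ∫ x in cube n S, ∫ z in cube n S, towerG' lab f S F (x, z) := integral_prod _ hG'i
      _ = ∫ x in cube n S, F x * Real.exp (-f x) := by
          congr 1
          funext x
          exact setIntegral_towerG' lab hf hS F x
  unfold cubeMean
  rw [hchain]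

end Tower

/-! ## §2 Block factorisation and the Markov ∕ total-covariance identity across a separating shell «(D2)» -/

section Markov

/-- A label taking the value `2` off `{lab ≠ 2}`: relabel so that exactly the OUTSIDE block is exchanged by
`swapEquiv`. [folklore] -/
def olab (lab : Fin n → Fin 3) (i : Fin n) : Fin 3 := if lab i = 2 then 0 else 1

/-- `olab lab` marks every non-outside coordinate as shell (`1`). [folklore] -/
private theorem olab_eq_one {lab : Fin n → Fin 3} {i : Fin n} (hi : lab i ≠ 2) : olab lab i = 1 := by
  simp only [olab, hi, if_false]

/-- `olab lab` marks every outside coordinate as non-shell. [folklore] -/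
private theorem olab_ne_one {lab : Fin n → Fin 3} {i : Fin n} (hi : lab i = 2) : olab lab i ≠ 1 := by
  simp only [olab, hi, if_true]
  decide

/-- Trichotomy in `Fin 3`: neither `0` nor `1` means `2`. [folklore] -/
private theorem fin3_eq_two {c : Fin 3} (h0 : c ≠ 0) (h1 : c ≠ 1) : c = 2 := by
  fin_cases c <;> simp_all

/-- **BLOCK FACTORISATION on the cube.**  If `a` is blind to the outside block and `b` sees only the outside
block, then `vol(K) · ∫_K a b = (∫_K a)(∫_K b)` — proved by the outside-block exchange involution on `K × K`
and `integral_prod_mul`. [cite: Durrett2019, Thm 2.1.12; FriedliVelenik2017, Exercise 3.11 (3.26)] -/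
theorem volumeReal_mul_setIntegral_mul (lab : Fin n → Fin 3) (S : ℝ) {a b : (Fin n → ℝ) → ℝ}
    (had : DependsOn a {i | lab i ≠ 2}) (hbd : DependsOn b {i | lab i = 2}) :
    (volume : Measure (Fin n → ℝ)).real (cube n S) * ∫ z in cube n S, a z * b z
      = (∫ z in cube n S, a z) * ∫ z in cube n S, b z := by
  have hμ : ((volume : Measure (Fin n → ℝ)).restrict (cube n S)).prod
      ((volume : Measure (Fin n → ℝ)).restrict (cube n S))
      = (volume : Measure ((Fin n → ℝ) × (Fin n → ℝ))).restrict (cube n S ×ˢ cube n S) := by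
    rw [Measure.prod_restrict, ← Measure.volume_eq_prod]
  have ha' : ∀ z w : Fin n → ℝ, a (merge (olab lab) z w) = a z := fun z w =>
    had fun i hi => merge_apply_shell (olab_eq_one hi) z w
  have hb' : ∀ z w : Fin n → ℝ, b (merge (olab lab) z w) = b w := fun z w =>
    hbd fun i hi => merge_apply_of_ne (olab_ne_one hi) z w
  have hV : ∫ _z in cube n S, (1 : ℝ) = (volume : Measure (Fin n → ℝ)).real (cube n S) := by
    rw [setIntegral_const, smul_eq_mul, mul_one]
  calc (volume : Measure (Fin n → ℝ)).real (cube n S) * ∫ z in cube n S, a z * b z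
      = (∫ z in cube n S, a z * b z) * ∫ _w in cube n S, (1 : ℝ) := by rw [hV, mul_comm]
    _ = ∫ p, (a p.1 * b p.1) * (1 : ℝ) ∂(((volume : Measure (Fin n → ℝ)).restrict (cube n S)).prod
          ((volume : Measure (Fin n → ℝ)).restrict (cube n S))) :=
        (integral_prod_mul (fun z => a z * b z) (fun _ => (1 : ℝ))).symm
    _ = ∫ p in cube n S ×ˢ cube n S, (a p.1 * b p.1) * (1 : ℝ) := by rw [hμ]
    _ = ∫ p in cube n S ×ˢ cube n S, (a (swapEquiv (olab lab) p).1 * b (swapEquiv (olab lab) p).1) * (1 : ℝ) :=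
        ((measurePreserving_swapEquiv_restrict (olab lab) S).integral_comp'
          (fun p => (a p.1 * b p.1) * (1 : ℝ))).symm
    _ = ∫ p in cube n S ×ˢ cube n S, a p.1 * b p.2 := by
        congr 1
        funext p
        rw [swapEquiv_apply]
        simp only [ha', hb', mul_one]
    _ = ∫ p, a p.1 * b p.2 ∂(((volume : Measure (Fin n → ℝ)).restrict (cube n S)).prod
          ((volume : Measure (Fin n → ℝ)).restrict (cube n S))) := by rw [hμ]
    _ = (∫ z in cube n S, a z) * ∫ z in cube n S, b z := integral_prod_mul a b

/-- `merge lab x ·` transports coordinate agreement on any index set. [cite: FriedliVelenik2017, Lemma 6.7 (6.7)–(6.10)] -/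
theorem merge_congr_right (lab : Fin n → Fin 3) (x : Fin n → ℝ) {z z' : Fin n → ℝ} {s : Set (Fin n)}
    (h : ∀ i ∈ s, z i = z' i) : ∀ i ∈ s, merge lab x z i = merge lab x z' i := by
  intro i hi
  by_cases h1 : lab i = 1
  · rw [merge_apply_shell h1, merge_apply_shell h1]
  · rw [merge_apply_of_ne h1, merge_apply_of_ne h1]
    exact h i hi

/-- A function depending only on the coordinates in `s` does not see, through `merge lab x ·`, a change of `z`
off `s`. [cite: FriedliVelenik2017, Lemma 6.3] -/
theorem apply_merge_eq_of_dependsOn {lab : Fin n → Fin 3} {Φ : (Fin n → ℝ) → ℝ} {s : Set (Fin n)}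
    (hΦ : DependsOn Φ s) (x : Fin n → ℝ) {z z' : Fin n → ℝ} (h : ∀ i ∈ s, z i = z' i) :
    Φ (merge lab x z) = Φ (merge lab x z') :=
  hΦ (merge_congr_right lab x h)

/-- A function blind to the INSIDE block, composed with `merge lab x ·`, sees only the outside block of `z`.
[cite: FriedliVelenik2017, Lemma 6.3] -/
theorem apply_merge_eq_of_dependsOn_outside {lab : Fin n → Fin 3} {Ψ : (Fin n → ℝ) → ℝ}
    (hΨ : DependsOn Ψ {i | lab i ≠ 0}) (x : Fin n → ℝ) {z z' : Fin n → ℝ}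
    (h : ∀ i ∈ {i | lab i = 2}, z i = z' i) : Ψ (merge lab x z) = Ψ (merge lab x z') := by
  apply hΨ
  intro i hi
  by_cases h1 : lab i = 1
  · rw [merge_apply_shell h1, merge_apply_shell h1]
  · rw [merge_apply_of_ne h1, merge_apply_of_ne h1]
    exact h i (fin3_eq_two hi h1)

/-- Cancelling a common nonzero factor (the cube volume `V`) from two factorised products:
`V·X = A·C`, `V·Y = B·C` ⇒ `X/Y = A/B`. [folklore] -/
private theorem div_eq_div_of_factor {V X Y A B C : ℝ} (hV : V ≠ 0) (hY : Y ≠ 0) (hB : B ≠ 0)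
    (h1 : V * X = A * C) (h2 : V * Y = B * C) : X / Y = A / B := by
  rw [div_eq_div_iff hY hB]
  exact mul_left_cancel₀ hV (by linear_combination B * h1 - A * h2)

/-- As `div_eq_div_of_factor` with the factorisations written `C·A`, `C·B`. [folklore] -/
private theorem div_eq_div_of_factor' {V X Y A B C : ℝ} (hV : V ≠ 0) (hY : Y ≠ 0) (hB : B ≠ 0)
    (h1 : V * X = C * A) (h2 : V * Y = C * B) : X / Y = A / B := by
  rw [div_eq_div_iff hY hB]
  exact mul_left_cancel₀ hV (by linear_combination B * h1 - A * h2)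

/-- Cancelling the cube volume from a doubly factorised pair: `V·X = A·A'`, `V·Y = B·B'` ⇒ `X/Y = (A/B)·(A'/B')`.
[folklore] -/
private theorem div_eq_div_mul_div_of_factor {V X Y A B A' B' : ℝ} (hV : V ≠ 0) (hY : Y ≠ 0) (hB : B ≠ 0)
    (hB' : B' ≠ 0) (h1 : V * X = A * A') (h2 : V * Y = B * B') : X / Y = A / B * (A' / B') := by
  rw [div_mul_div_comm, div_eq_div_iff hY (mul_ne_zero hB hB')]
  exact mul_left_cancel₀ hV (by linear_combination (B * B') * h1 - (A * A') * h2)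

/-- **ONE-SIDED CONDITIONAL MEANS (PROVED).**  Across a separating shell (`f = f₁ + f₂`, `f₁, F` blind to the
outside block, `f₂, H` blind to the inside block) the shell-conditional means FACTORISE:
`E_f[F|shell] = E_{f₁}[F|shell]`, `E_f[H|shell] = E_{f₂}[H|shell]`, `E_f[FH|shell] = E_{f₁}[F|shell]·E_{f₂}[H|shell]`.
[cite: FriedliVelenik2017, Exercise 3.11 (3.26); FriedliVelenik2017, §6.10.1 (6.110)] -/
theorem shellMean_split {S : ℝ} (hS : 0 < S) (lab : Fin n → Fin 3) {f₁ f₂ F H : (Fin n → ℝ) → ℝ}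
    (hf₁ : Continuous f₁) (hf₂ : Continuous f₂)
    (hf₁d : DependsOn f₁ {i | lab i ≠ 2}) (hFd : DependsOn F {i | lab i ≠ 2})
    (hf₂d : DependsOn f₂ {i | lab i ≠ 0}) (hHd : DependsOn H {i | lab i ≠ 0}) (x : Fin n → ℝ) :
    shellMean lab (f₁ + f₂) S F x = shellMean lab f₁ S F x ∧
    shellMean lab (f₁ + f₂) S H x = shellMean lab f₂ S H x ∧
    shellMean lab (f₁ + f₂) S (fun y => F y * H y) x = shellMean lab f₁ S F x * shellMean lab f₂ S H x := by
  have hK : IsCompact (cube n S) := isCompact_cube n S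
  have hV : (volume : Measure (Fin n → ℝ)).real (cube n S) ≠ 0 := by
    rw [measureReal_def]
    exact (ENNReal.toReal_pos (volume_cube_pos' n hS).ne' hK.measure_lt_top.ne).ne'
  set aF : (Fin n → ℝ) → ℝ := fun z => F (merge lab x z) * Real.exp (-f₁ (merge lab x z)) with haF
  set a1 : (Fin n → ℝ) → ℝ := fun z => Real.exp (-f₁ (merge lab x z)) with ha1
  set bH : (Fin n → ℝ) → ℝ := fun z => H (merge lab x z) * Real.exp (-f₂ (merge lab x z)) with hbH
  set b1 : (Fin n → ℝ) → ℝ := fun z => Real.exp (-f₂ (merge lab x z)) with hb1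
  -- block dependence
  have daF : DependsOn aF {i | lab i ≠ 2} := by
    intro z z' h
    simp only [haF]
    rw [apply_merge_eq_of_dependsOn hFd x h, apply_merge_eq_of_dependsOn hf₁d x h]
  have da1 : DependsOn a1 {i | lab i ≠ 2} := by
    intro z z' h
    simp only [ha1]
    rw [apply_merge_eq_of_dependsOn hf₁d x h]
  have dbH : DependsOn bH {i | lab i = 2} := by
    intro z z' h
    simp only [hbH]
    rw [apply_merge_eq_of_dependsOn_outside hHd x h, apply_merge_eq_of_dependsOn_outside hf₂d x h]
  have db1 : DependsOn b1 {i | lab i = 2} := by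
    intro z z' h
    simp only [hb1]
    rw [apply_merge_eq_of_dependsOn_outside hf₂d x h]
  -- the four factorisations
  have h11 := volumeReal_mul_setIntegral_mul lab S da1 db1
  have hF1 := volumeReal_mul_setIntegral_mul lab S daF db1
  have h1H := volumeReal_mul_setIntegral_mul lab S da1 dbH
  have hFH := volumeReal_mul_setIntegral_mul lab S daF dbH
  -- positivity of the denominators
  have hA1 : (∫ z in cube n S, a1 z) ≠ 0 := (shellMass_pos lab hf₁ hS x).ne'
  have hB1 : (∫ z in cube n S, b1 z) ≠ 0 := (shellMass_pos lab hf₂ hS x).ne'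
  have hf : Continuous (f₁ + f₂) := hf₁.add hf₂
  have eM : shellMass lab (f₁ + f₂) S x = ∫ z in cube n S, a1 z * b1 z := by
    show (∫ z in cube n S, Real.exp (-(f₁ + f₂) (merge lab x z))) = _
    congr 1
    funext z
    simp only [ha1, hb1, Pi.add_apply, neg_add, Real.exp_add]
  have hY : (∫ z in cube n S, a1 z * b1 z) ≠ 0 := by
    rw [← eM]
    exact (shellMass_pos lab hf hS x).ne'
  -- the three numerators
  have nF : (∫ z in cube n S, F (merge lab x z) * Real.exp (-(f₁ + f₂) (merge lab x z)))
      = ∫ z in cube n S, aF z * b1 z := by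
    congr 1
    funext z
    simp only [haF, hb1, Pi.add_apply, neg_add, Real.exp_add]
    ring
  have nH : (∫ z in cube n S, H (merge lab x z) * Real.exp (-(f₁ + f₂) (merge lab x z)))
      = ∫ z in cube n S, a1 z * bH z := by
    congr 1
    funext z
    simp only [ha1, hbH, Pi.add_apply, neg_add, Real.exp_add]
    ring
  have nFH : (∫ z in cube n S, F (merge lab x z) * H (merge lab x z) * Real.exp (-(f₁ + f₂) (merge lab x z)))
      = ∫ z in cube n S, aF z * bH z := by
    congr 1
    funext z
    simp only [haF, hbH, Pi.add_apply, neg_add, Real.exp_add]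
    ring
  have eF : shellMean lab f₁ S F x = (∫ z in cube n S, aF z) / ∫ z in cube n S, a1 z := rfl
  have eH : shellMean lab f₂ S H x = (∫ z in cube n S, bH z) / ∫ z in cube n S, b1 z := rfl
  refine ⟨?_, ?_, ?_⟩
  · show (∫ z in cube n S, F (merge lab x z) * Real.exp (-(f₁ + f₂) (merge lab x z)))
        / shellMass lab (f₁ + f₂) S x = _
    rw [nF, eM, eF]
    exact div_eq_div_of_factor hV hY hA1 hF1 h11
  · show (∫ z in cube n S, H (merge lab x z) * Real.exp (-(f₁ + f₂) (merge lab x z)))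
        / shellMass lab (f₁ + f₂) S x = _
    rw [nH, eM, eH]
    exact div_eq_div_of_factor' hV hY hB1 h1H h11
  · show (∫ z in cube n S, F (merge lab x z) * H (merge lab x z) * Real.exp (-(f₁ + f₂) (merge lab x z)))
        / shellMass lab (f₁ + f₂) S x = _
    rw [nFH, eM, eF, eH]
    exact div_eq_div_mul_div_of_factor hV hY hA1 hB1 hFH h11

/-- **(D2) MARKOV ∕ TOTAL COVARIANCE ACROSS A SEPARATING SHELL (PROVED).**  If the potential splits
`f = f₁ + f₂` with `f₁` blind to the OUTSIDE block (`lab = 2`) and `f₂` blind to the INSIDE block (`lab = 0`)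
(finite range `<` shell thickness), and the inserts `F` (blind to outside) and `H` (blind to inside) live on
opposite sides, then `Cov_μ(F, H) = Cov_μ(E[F | x_shell], E[H | x_shell])` EXACTLY, the two conditional means
being the ONE-SIDED shell means `shellMean lab f₁ S F`, `shellMean lab f₂ S H` (functions of the shell variables,
`shellMean_dependsOn`).  Proof: `cubeCov_eq_sub` on both sides, the tower property `cubeMean_shellMean` for
`F·H`, `F`, `H`, and the factorisation `shellMean_split`. [cite: FriedliVelenik2017, Exercise 3.11 (3.26); FriedliVelenik2017, Lemma 6.7 (6.7)–(6.10)] -/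
theorem cubeCov_markov {S : ℝ} (hS : 0 < S) (lab : Fin n → Fin 3) {f₁ f₂ F H : (Fin n → ℝ) → ℝ}
    (hf₁ : Continuous f₁) (hf₂ : Continuous f₂) (hF : Continuous F) (hH : Continuous H)
    (hf₁d : DependsOn f₁ {i | lab i ≠ 2}) (hFd : DependsOn F {i | lab i ≠ 2})
    (hf₂d : DependsOn f₂ {i | lab i ≠ 0}) (hHd : DependsOn H {i | lab i ≠ 0}) :
    cubeCov (f₁ + f₂) S F H = cubeCov (f₁ + f₂) S (shellMean lab f₁ S F) (shellMean lab f₂ S H) := by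
  have hf : Continuous (f₁ + f₂) := hf₁.add hf₂
  have hu : Continuous (shellMean lab f₁ S F) := continuous_shellMean lab hf₁ hF hS
  have hv : Continuous (shellMean lab f₂ S H) := continuous_shellMean lab hf₂ hH hS
  have hFH : Continuous fun y => F y * H y := hF.mul hH
  have P := fun x => shellMean_split hS lab hf₁ hf₂ hf₁d hFd hf₂d hHd x (F := F) (H := H)
  have e1 : shellMean lab (f₁ + f₂) S F = shellMean lab f₁ S F := funext fun x => (P x).1
  have e2 : shellMean lab (f₁ + f₂) S H = shellMean lab f₂ S H := funext fun x => (P x).2.1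
  have e3 : shellMean lab (f₁ + f₂) S (fun y => F y * H y)
      = fun y => shellMean lab f₁ S F y * shellMean lab f₂ S H y := funext fun x => (P x).2.2
  rw [cubeCov_eq_sub hS hf hF hH, cubeCov_eq_sub hS hf hu hv, cubeMean_shellMean hS lab hf hFH,
    cubeMean_shellMean hS lab hf hF, cubeMean_shellMean hS lab hf hH, e1, e2, e3]

end Markov

end Literature.MathematicalPhysics.QuantumFieldTheory.Balaban1983to89.T4CubeShellTowerMarkov
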